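import Summits.QuantumFields.YangMills.Theorems.FlatTubeReductionSlowBoundFibreSplit
import Summits.QuantumFields.YangMills.Theorems.FlatTubeReductionOutputWeightDomination
import Summits.QuantumFields.YangMills.Theorems.FlatTubeReductionCoreDefectOrbitMomentSq
import HarnessLib

/-!
# The first term of the core `L²` estimate as EIGHT FIBRE FACTORS against the capped inner weight

Support file for the crux `NearFlatRatioLaw` (line `ratepack_v2`, stub `stub_hODpot_A`; successor step (A) of
`Cruxes/NearFlatRatioLaw/Lines/ratepack-v7-moments-g18.md` §14, record half; memo v8 (g19)).

`…CoreDefectRecordOrbitMomentsQuasi.defect_core_sq_record_orbit_moments_quasi` bounds the record core `L²` quantity by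
`prefactor·∫dπ(v) w(v)·S(v) + tail`, `w(v) = 𝟙{‖x_v‖ ≤ R_in}e^{-q(x_v)}e^{-‖P_Γx_v‖²/δg²}` the output weight and `S(v)` the slow side.  Here:
★★ `integral_outputWeight_mul_slow_side_le_fibre_factors` — for an abstract profile `Ω ≥ 0` (bounded, measurable, supported in a ball), core weight `W ≥ 0`,
colour-blind exponent `q β ≥ 0` and the scalar data of `…SlowSideAssembly.slow_side_le`,
`∫dπ w·S ≤ [(40(1+η_c)(a₀₀F₀₀ + a₀₂F₀₂ + a₀₄F₀₄ + a₁(F₁+F₂) + a₃(F₃+F₄)) + a_E F_E)‖φ‖² + 40(1+η_c)(p₀₀F₀₀ + p₀₂F₀₂ + p₁(F₁+F₂))∫orbitDist²φ²]/K₁(1,1)²`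
with the fibre factors `F₀ₐ = ∫dπ Ω₁(x_v)‖x_v‖^{2a}𝒴₀(v)`, `F_i = ∫dπ Ω₁(x_v)𝒴_i(v)`, `F_E = ∫dπ Ω₁(x_v)e^{-q(x_v)}`, `Ω₁` = the CAPPED inner weight of
`…OutputWeightDomination` (`∫dπ w·X = ∫dπ Ω₁(x_v)·X`, `integral_outputWeight_eq_capInnerWeight`) — exactly the left sides of
`…RecordFibreFactor.record_fibre_factor_le_reference_mass` once `Ω, W, q` are the record data.  Proof: (R3e) switch, then
`…SlowBoundFibreSplit.integral_le_slow_bound_split_of_le` with `Φ = Ω₁·S ≤ Ω₁·SB` (`slow_side_le`), the measurability / boundedness of the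
five colour-averaged central transfers being those of `…CoreDefectOrbitMomentSq`.
-/

noncomputable section

open MeasureTheory Filter Topology Real
open scoped BigOperators
open Literature.MathematicalPhysics.QuantumFieldTheory
open Literature.MathematicalPhysics.QuantumLattice

namespace Summit.QuantumFields.YangMills.Theorems.FemtoTransferGap.TwoLattice.ConstTube

open Summit.QuantumFields.YangMills.Theorems.FemtoTransferGap
open Summit.QuantumFields.YangMills.Theorems.FemtoTransferGap.TwoLattice
open Summit.QuantumFields.YangMills.Theorems.FemtoTransferGap.TwoLattice.Avg
open Summit.QuantumFields.YangMills.Theorems.FemtoTransferGap.TwoLattice.Stiff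
open Summit.QuantumFields.YangMills.Theorems.FemtoTransferGap.TwoLattice.GnChart

variable {L : ℕ} [NeZero L]

/-- The capped inner weight lies in `[0, 1]` when `q β ≥ 0`. [folklore] -/
theorem capInnerWeight_mem_Icc {q : ℝ → LinkSpace L → ℝ} {β : ℝ} (hq0 : ∀ x, 0 ≤ q β x) (Rin : ℝ) (x : LinkSpace L) :
    0 ≤ {x : LinkSpace L | linkCurry x ∈ capBalancedSet L}.indicator (fun _ => (1 : ℝ)) x *
      ({x : LinkSpace L | ‖x‖ ≤ Rin}.indicator (fun _ => (1 : ℝ)) x * (Real.exp (-(q β x)) * Real.exp (-(‖(gaugeModes L).starProjection x‖ ^ 2 / powScale 1 β ^ 2)))) ∧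
      {x : LinkSpace L | linkCurry x ∈ capBalancedSet L}.indicator (fun _ => (1 : ℝ)) x *
      ({x : LinkSpace L | ‖x‖ ≤ Rin}.indicator (fun _ => (1 : ℝ)) x * (Real.exp (-(q β x)) * Real.exp (-(‖(gaugeModes L).starProjection x‖ ^ 2 / powScale 1 β ^ 2)))) ≤ 1 := by
  have hi1 : ∀ (s : Set (LinkSpace L)), 0 ≤ s.indicator (fun _ => (1 : ℝ)) x ∧ s.indicator (fun _ => (1 : ℝ)) x ≤ 1 := fun s => by
    by_cases hx : x ∈ s
    · rw [Set.indicator_of_mem hx]; exact ⟨zero_le_one, le_rfl⟩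
    · rw [Set.indicator_of_notMem hx]; exact ⟨le_rfl, zero_le_one⟩
  have he1 : Real.exp (-(q β x)) ≤ 1 := Real.exp_le_one_iff.mpr (by linarith [hq0 x])
  have he2 : Real.exp (-(‖(gaugeModes L).starProjection x‖ ^ 2 / powScale 1 β ^ 2)) ≤ 1 :=
    Real.exp_le_one_iff.mpr (by have := div_nonneg (sq_nonneg ‖(gaugeModes L).starProjection x‖) (sq_nonneg (powScale 1 β)); linarith)
  have hee : 0 ≤ Real.exp (-(q β x)) * Real.exp (-(‖(gaugeModes L).starProjection x‖ ^ 2 / powScale 1 β ^ 2)) ∧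
      Real.exp (-(q β x)) * Real.exp (-(‖(gaugeModes L).starProjection x‖ ^ 2 / powScale 1 β ^ 2)) ≤ 1 :=
    ⟨mul_nonneg (Real.exp_nonneg _) (Real.exp_nonneg _), mul_le_one₀ he1 (Real.exp_nonneg _) he2⟩
  have h2 := hi1 {x : LinkSpace L | ‖x‖ ≤ Rin}
  have h1 := hi1 {x : LinkSpace L | linkCurry x ∈ capBalancedSet L}
  exact ⟨mul_nonneg h1.1 (mul_nonneg h2.1 hee.1), mul_le_one₀ h1.2 (mul_nonneg h2.1 hee.1) (mul_le_one₀ h2.2 hee.1 hee.2)⟩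

/-- The capped inner weight vanishes unless `‖x‖² ≤ R_in²`. [folklore] -/
theorem sq_norm_le_of_capInnerWeight_ne_zero {q : ℝ → LinkSpace L → ℝ} {β : ℝ} (Rin : ℝ) (x : LinkSpace L)
    (hx : {x : LinkSpace L | linkCurry x ∈ capBalancedSet L}.indicator (fun _ => (1 : ℝ)) x *
      ({x : LinkSpace L | ‖x‖ ≤ Rin}.indicator (fun _ => (1 : ℝ)) x * (Real.exp (-(q β x)) * Real.exp (-(‖(gaugeModes L).starProjection x‖ ^ 2 / powScale 1 β ^ 2)))) ≠ 0) :
    ‖x‖ ^ 2 ≤ Rin ^ 2 := by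
  by_cases h : ‖x‖ ≤ Rin
  · exact pow_le_pow_left₀ (norm_nonneg _) h 2
  · exfalso; apply hx
    have : x ∉ {x : LinkSpace L | ‖x‖ ≤ Rin} := h
    rw [Set.indicator_of_notMem this, zero_mul, mul_zero]

set_option maxRecDepth 4096 in
set_option maxHeartbeats 4000000 in
-- 30-kB statement (the slow side and its eight-fibre-factor bound written out); the proof is the (R3e) switch, `slow_side_le` pointwise and `integral_le_slow_bound_split_of_le`.
/-- ★★ **THE FIRST TERM OF THE CORE `L²` ESTIMATE AS EIGHT FIBRE FACTORS** (see the module docstring). [cite: Luscher1983, §3] -/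
theorem integral_outputWeight_mul_slow_side_le_fibre_factors {β : ℝ} (hβ1 : 1 ≤ β) {q : ℝ → LinkSpace L → ℝ} (hqm : Measurable (q β)) (hq0 : ∀ x, 0 ≤ q β x)
    {Ω : LinkSpace L → ℝ} (hΩm : Measurable Ω) {CΩ : ℝ} (hCΩ : ∀ x, |Ω x| ≤ CΩ) (hΩ0 : ∀ x, 0 ≤ Ω x) {R : ℝ} (hΩR : ∀ x, Ω x ≠ 0 → ‖x‖ ≤ R)
    {W : (Site 3 L → SU2) → ℝ} (hWm : Measurable W) {CW : ℝ} (hCW : ∀ g, |W g| ≤ CW) (hW0 : ∀ g, 0 ≤ W g)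
    {dO Rin Γ c₂ m : ℝ} (hΓ : 0 ≤ Γ) (hc₂ : 0 ≤ c₂) (hm : 0 ≤ m) {cq a₀' ηc : ℝ} (hcq : 0 ≤ cq) (ha₀' : 0 ≤ a₀') (hηc : 0 ≤ ηc)
    {φ : GaugeConfig 3 1 SU2 → ℝ} (hφm : Measurable φ) {Cφ : ℝ} (hφb : ∀ u, |φ u| ≤ Cφ) :
    ∫ v, {v : Edge 3 L → Fin 3 → ℝ | ‖linkEmbed L v‖ ≤ Rin}.indicator (fun _ => (1 : ℝ)) v *
        (Real.exp (-(q β (linkEmbed L v))) * Real.exp (-(‖(gaugeModes L).starProjection (linkEmbed L v)‖ ^ 2 / powScale 1 β ^ 2))) *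
      ∫ u, {u : GaugeConfig 3 1 SU2 | orbitDist u ≤ dO}.indicator (fun _ => (1 : ℝ)) u *
        ((∫ w, φ w ^ 2 * (avgKernel ((L : ℝ) ^ 3 * β) u w / transferKernel su2Rep ((L : ℝ) ^ 3 * β) (1 : GaugeConfig 3 1 SU2) 1) ∂configMeasure SU2 1) *
              (40 * (1 + ηc) *
                  ((∫ w, (216 * β * (orbitDist u + orbitDist w) * orbitDist u * Γ +
                    300000000 * ((Fintype.card (Edge 3 L) : ℝ) + (Fintype.card (Plaquette 3 L × Fin 3) : ℝ) + (Fintype.card (Plaquette 3 L) : ℝ)) *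
                        (β * ((4 + Real.sqrt (8 * (Fintype.card (Plaquette 3 1) : ℝ) * (L : ℝ) ^ 3)) * (orbitDist u + orbitDist w)) + Real.sqrt β / 2) * min (‖linkEmbed L v‖ ^ 2) (Rin ^ 2) +
                    3 * c₂ * (min (‖linkEmbed L v‖ ^ 2) (Rin ^ 2)) ^ 2) ^ 2 * (avgKernel ((L : ℝ) ^ 3 * β) u w / transferKernel su2Rep ((L : ℝ) ^ 3 * β) (1 : GaugeConfig 3 1 SU2) 1) ∂configMeasure SU2 1) *
                    (∫ c, fpFibreTransfer L β Ω W (gaugeTransform (fun _ : Site 3 L => c⁻¹) (orthoTube L 1 v)) 1 ∂haarProbability SU2) +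
                  (∫ w, (300000000 * ((Fintype.card (Edge 3 L) : ℝ) + (Fintype.card (Plaquette 3 L × Fin 3) : ℝ) + (Fintype.card (Plaquette 3 L) : ℝ)) *
                        (β * ((4 + Real.sqrt (8 * (Fintype.card (Plaquette 3 1) : ℝ) * (L : ℝ) ^ 3)) * (orbitDist u + orbitDist w)) + Real.sqrt β / 2)) ^ 2 * (avgKernel ((L : ℝ) ^ 3 * β) u w / transferKernel su2Rep ((L : ℝ) ^ 3 * β) (1 : GaugeConfig 3 1 SU2) 1) ∂configMeasure SU2 1) *
                    ((∫ c, fpFibreTransfer L β (fun x => Ω x * (‖x‖ ^ 2) ^ 2) W (gaugeTransform (fun _ : Site 3 L => c⁻¹) (orthoTube L 1 v)) 1 ∂haarProbability SU2) + (∫ c, fpFibreTransfer L β Ω (fun g => W g * (∑ x, ‖su2Quat (g x) - 1‖ ^ 2) ^ 2) (gaugeTransform (fun _ : Site 3 L => c⁻¹) (orthoTube L 1 v)) 1 ∂haarProbability SU2)) +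
                  9 * c₂ ^ 2 * (∫ w, (avgKernel ((L : ℝ) ^ 3 * β) u w / transferKernel su2Rep ((L : ℝ) ^ 3 * β) (1 : GaugeConfig 3 1 SU2) 1) ∂configMeasure SU2 1) *
                    ((∫ c, fpFibreTransfer L β (fun x => Ω x * (‖x‖ ^ 2) ^ 4) W (gaugeTransform (fun _ : Site 3 L => c⁻¹) (orthoTube L 1 v)) 1 ∂haarProbability SU2) + (∫ c, fpFibreTransfer L β Ω (fun g => W g * (∑ x, ‖su2Quat (g x) - 1‖ ^ 2) ^ 4) (gaugeTransform (fun _ : Site 3 L => c⁻¹) (orthoTube L 1 v)) 1 ∂haarProbability SU2))) +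
                2 * ηc ^ 2 * (cq * (a₀' * Real.exp (-(q β (linkEmbed L v))))) * ∫ w, (avgKernel ((L : ℝ) ^ 3 * β) u w / transferKernel su2Rep ((L : ℝ) ^ 3 * β) (1 : GaugeConfig 3 1 SU2) 1) ∂configMeasure SU2 1)) ∂configMeasure SU2 1 ∂orthoTransverse L ≤
      (((40 * (1 + ηc) * ((2 * ((14 * (216 * β * Γ) ^ 2 * dO ^ 2 + 8 * (216 * β * Γ) ^ 2 * m ^ 2) * linkCE ((L : ℝ) ^ 3 * β) + 4 * (216 * β * Γ) ^ 2 * ((4 * (Fintype.card (Edge 3 1) : ℝ)) ^ 2 * crossBound 1 ((L : ℝ) ^ 3 * β) m)) * m ^ 2 * linkCE ((L : ℝ) ^ 3 * β) + ((14 * (216 * β * Γ) ^ 2 * dO ^ 2 + 8 * (216 * β * Γ) ^ 2 * m ^ 2) * linkCE ((L : ℝ) ^ 3 * β) + 4 * (216 * β * Γ) ^ 2 * ((4 * (Fintype.card (Edge 3 1) : ℝ)) ^ 2 * crossBound 1 ((L : ℝ) ^ 3 * β) m)) * ((4 * (Fintype.card (Edge 3 1) : ℝ)) ^ 2 * crossBound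 1 ((L : ℝ) ^ 3 * β) m)) * (∫ v, {x : LinkSpace L | linkCurry x ∈ capBalancedSet L}.indicator (fun _ => (1 : ℝ)) (linkEmbed L v) *
          ({x : LinkSpace L | ‖x‖ ≤ Rin}.indicator (fun _ => (1 : ℝ)) (linkEmbed L v) *
            (Real.exp (-(q β (linkEmbed L v))) * Real.exp (-(‖(gaugeModes L).starProjection (linkEmbed L v)‖ ^ 2 / powScale 1 β ^ 2)))) * (∫ c, fpFibreTransfer L β Ω W (gaugeTransform (fun _ : Site 3 L => c⁻¹) (orthoTube L 1 v)) 1 ∂haarProbability SU2) ∂orthoTransverse L) + (((3 * (300000000 * ((Fintype.card (Edge 3 L) : ℝ) + (Fintype.card (Plaquette 3 L × Fin 3) : ℝ) + (Fintype.card (Plaquette 3 L) : ℝ))) ^ 2 * β + 8 * ((300000000 * ((Fintype.card (Edge 3 L) : ℝ) + (Fintype.card (Plaquette 3 L × Fin 3) : ℝ) + (Fintype.card (Plaquette 3 L) : ℝ))) ^ 2 * β ^ 2 * (4 + Real.sqrt (8 * (Fintype.card (Plaquette 3 1) : ℝ) * (L : ℝ) ^ 3)) ^ 2) * m ^ 2)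 * linkCE ((L : ℝ) ^ 3 * β) + 4 * ((300000000 * ((Fintype.card (Edge 3 L) : ℝ) + (Fintype.card (Plaquette 3 L × Fin 3) : ℝ) + (Fintype.card (Plaquette 3 L) : ℝ))) ^ 2 * β ^ 2 * (4 + Real.sqrt (8 * (Fintype.card (Plaquette 3 1) : ℝ) * (L : ℝ) ^ 3)) ^ 2) * ((4 * (Fintype.card (Edge 3 1) : ℝ)) ^ 2 * crossBound 1 ((L : ℝ) ^ 3 * β) m) + 2 * (20 * ((300000000 * ((Fintype.card (Edge 3 L) : ℝ) + (Fintype.card (Plaquette 3 L × Fin 3) : ℝ) + (Fintype.card (Plaquette 3 L) : ℝ))) ^ 2 * β ^ 2 * (4 + Real.sqrt (8 * (Fintype.card (Plaquette 3 1) : ℝ) * (L : ℝ) ^ 3)) ^ 2) * linkCE ((L : ℝ) ^ 3 * β)) * m ^ 2) * linkCE ((L : ℝ) ^ 3 * β) + (20 * ((300000000 * ((Fintype.card (Edge 3 L) : ℝ) + (Fintype.card (Plaquette 3 L × Fin 3) : ℝ) + (Fintype.card (Plaquette 3 L) : ℝ))) ^ 2 * β ^ 2 * (4 + Real.sqrt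 (8 * (Fintype.card (Plaquette 3 1) : ℝ) * (L : ℝ) ^ 3)) ^ 2) * linkCE ((L : ℝ) ^ 3 * β)) * ((4 * (Fintype.card (Edge 3 1) : ℝ)) ^ 2 * crossBound 1 ((L : ℝ) ^ 3 * β) m)) * (∫ v, {x : LinkSpace L | linkCurry x ∈ capBalancedSet L}.indicator (fun _ => (1 : ℝ)) (linkEmbed L v) *
          ({x : LinkSpace L | ‖x‖ ≤ Rin}.indicator (fun _ => (1 : ℝ)) (linkEmbed L v) *
            (Real.exp (-(q β (linkEmbed L v))) * Real.exp (-(‖(gaugeModes L).starProjection (linkEmbed L v)‖ ^ 2 / powScale 1 β ^ 2)))) * (‖linkEmbed L v‖ ^ 2) ^ 2 * (∫ c, fpFibreTransfer L β Ω W (gaugeTransform (fun _ : Site 3 L => c⁻¹) (orthoTube L 1 v)) 1 ∂haarProbability SU2) ∂orthoTransverse L) + (54 * c₂ ^ 2 * linkCE ((L : ℝ) ^ 3 * β) * linkCE ((L : ℝ) ^ 3 * β)) * (∫ v, {x : LinkSpace L | linkCurry x ∈ capBalancedSet L}.indicator (fun _ => (1 : ℝ)) (linkEmbed L v) *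
          ({x : LinkSpace L | ‖x‖ ≤ Rin}.indicator (fun _ => (1 : ℝ)) (linkEmbed L v) *
            (Real.exp (-(q β (linkEmbed L v))) * Real.exp (-(‖(gaugeModes L).starProjection (linkEmbed L v)‖ ^ 2 / powScale 1 β ^ 2)))) * (‖linkEmbed L v‖ ^ 2) ^ 4 * (∫ c, fpFibreTransfer L β Ω W (gaugeTransform (fun _ : Site 3 L => c⁻¹) (orthoTube L 1 v)) 1 ∂haarProbability SU2) ∂orthoTransverse L) + ((((300000000 * ((Fintype.card (Edge 3 L) : ℝ) + (Fintype.card (Plaquette 3 L × Fin 3) : ℝ) + (Fintype.card (Plaquette 3 L) : ℝ))) ^ 2 * β + 4 * ((300000000 * ((Fintype.card (Edge 3 L) : ℝ) + (Fintype.card (Plaquette 3 L × Fin 3) : ℝ) + (Fintype.card (Plaquette 3 L) : ℝ))) ^ 2 * β ^ 2 * (4 + Real.sqrt (8 * (Fintype.card (Plaquette 3 1) : ℝ) * (L : ℝ) ^ 3)) ^ 2) * m ^ 2) * linkCE ((L : ℝ) ^ 3 * β) + 2 * ((300000000 * ((Fintype.card (Edge 3 L) : ℝ) + (Fintype.card (Plaquette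 3 L × Fin 3) : ℝ) + (Fintype.card (Plaquette 3 L) : ℝ))) ^ 2 * β ^ 2 * (4 + Real.sqrt (8 * (Fintype.card (Plaquette 3 1) : ℝ) * (L : ℝ) ^ 3)) ^ 2) * ((4 * (Fintype.card (Edge 3 1) : ℝ)) ^ 2 * crossBound 1 ((L : ℝ) ^ 3 * β) m) + 16 * ((300000000 * ((Fintype.card (Edge 3 L) : ℝ) + (Fintype.card (Plaquette 3 L × Fin 3) : ℝ) + (Fintype.card (Plaquette 3 L) : ℝ))) ^ 2 * β ^ 2 * (4 + Real.sqrt (8 * (Fintype.card (Plaquette 3 1) : ℝ) * (L : ℝ) ^ 3)) ^ 2) * linkCE ((L : ℝ) ^ 3 * β) * m ^ 2) * linkCE ((L : ℝ) ^ 3 * β) + 8 * ((300000000 * ((Fintype.card (Edge 3 L) : ℝ) + (Fintype.card (Plaquette 3 L × Fin 3) : ℝ) + (Fintype.card (Plaquette 3 L) : ℝ))) ^ 2 * β ^ 2 * (4 + Real.sqrt (8 * (Fintype.card (Plaquette 3 1) : ℝ) * (L : ℝ) ^ 3)) ^ 2) * linkCE ((L : ℝ) ^ 3 * β) * ((4 *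 (Fintype.card (Edge 3 1) : ℝ)) ^ 2 * crossBound 1 ((L : ℝ) ^ 3 * β) m)) * ((∫ v, {x : LinkSpace L | linkCurry x ∈ capBalancedSet L}.indicator (fun _ => (1 : ℝ)) (linkEmbed L v) *
          ({x : LinkSpace L | ‖x‖ ≤ Rin}.indicator (fun _ => (1 : ℝ)) (linkEmbed L v) *
            (Real.exp (-(q β (linkEmbed L v))) * Real.exp (-(‖(gaugeModes L).starProjection (linkEmbed L v)‖ ^ 2 / powScale 1 β ^ 2)))) * (∫ c, fpFibreTransfer L β (fun x => Ω x * (‖x‖ ^ 2) ^ 2) W (gaugeTransform (fun _ : Site 3 L => c⁻¹) (orthoTube L 1 v)) 1 ∂haarProbability SU2) ∂orthoTransverse L) + (∫ v, {x : LinkSpace L | linkCurry x ∈ capBalancedSet L}.indicator (fun _ => (1 : ℝ)) (linkEmbed L v) *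
          ({x : LinkSpace L | ‖x‖ ≤ Rin}.indicator (fun _ => (1 : ℝ)) (linkEmbed L v) *
            (Real.exp (-(q β (linkEmbed L v))) * Real.exp (-(‖(gaugeModes L).starProjection (linkEmbed L v)‖ ^ 2 / powScale 1 β ^ 2)))) * (∫ c, fpFibreTransfer L β Ω (fun g => W g * (∑ x, ‖su2Quat (g x) - 1‖ ^ 2) ^ 2) (gaugeTransform (fun _ : Site 3 L => c⁻¹) (orthoTube L 1 v)) 1 ∂haarProbability SU2) ∂orthoTransverse L)) + (18 * c₂ ^ 2 * linkCE ((L : ℝ) ^ 3 * β) * linkCE ((L : ℝ) ^ 3 * β)) * ((∫ v, {x : LinkSpace L | linkCurry x ∈ capBalancedSet L}.indicator (fun _ => (1 : ℝ)) (linkEmbed L v) *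
          ({x : LinkSpace L | ‖x‖ ≤ Rin}.indicator (fun _ => (1 : ℝ)) (linkEmbed L v) *
            (Real.exp (-(q β (linkEmbed L v))) * Real.exp (-(‖(gaugeModes L).starProjection (linkEmbed L v)‖ ^ 2 / powScale 1 β ^ 2)))) * (∫ c, fpFibreTransfer L β (fun x => Ω x * (‖x‖ ^ 2) ^ 4) W (gaugeTransform (fun _ : Site 3 L => c⁻¹) (orthoTube L 1 v)) 1 ∂haarProbability SU2) ∂orthoTransverse L) + (∫ v, {x : LinkSpace L | linkCurry x ∈ capBalancedSet L}.indicator (fun _ => (1 : ℝ)) (linkEmbed L v) *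
          ({x : LinkSpace L | ‖x‖ ≤ Rin}.indicator (fun _ => (1 : ℝ)) (linkEmbed L v) *
            (Real.exp (-(q β (linkEmbed L v))) * Real.exp (-(‖(gaugeModes L).starProjection (linkEmbed L v)‖ ^ 2 / powScale 1 β ^ 2)))) * (∫ c, fpFibreTransfer L β Ω (fun g => W g * (∑ x, ‖su2Quat (g x) - 1‖ ^ 2) ^ 4) (gaugeTransform (fun _ : Site 3 L => c⁻¹) (orthoTube L 1 v)) 1 ∂haarProbability SU2) ∂orthoTransverse L))) + (4 * ηc ^ 2 * cq * a₀' * linkCE ((L : ℝ) ^ 3 * β) * linkCE ((L : ℝ) ^ 3 * β)) * (∫ v, {x : LinkSpace L | linkCurry x ∈ capBalancedSet L}.indicator (fun _ => (1 : ℝ)) (linkEmbed L v) *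
          ({x : LinkSpace L | ‖x‖ ≤ Rin}.indicator (fun _ => (1 : ℝ)) (linkEmbed L v) *
            (Real.exp (-(q β (linkEmbed L v))) * Real.exp (-(‖(gaugeModes L).starProjection (linkEmbed L v)‖ ^ 2 / powScale 1 β ^ 2)))) * Real.exp (-(q β (linkEmbed L v))) ∂orthoTransverse L)) * ∫ w, φ w ^ 2 ∂configMeasure SU2 1 +
          40 * (1 + ηc) * ((2 * ((14 * (216 * β * Γ) ^ 2 * dO ^ 2 + 8 * (216 * β * Γ) ^ 2 * m ^ 2) * linkCE ((L : ℝ) ^ 3 * β) + 4 * (216 * β * Γ) ^ 2 * ((4 * (Fintype.card (Edge 3 1) : ℝ)) ^ 2 * crossBound 1 ((L : ℝ) ^ 3 * β) m)) * linkCE ((L : ℝ) ^ 3 * β)) * (∫ v, {x : LinkSpace L | linkCurry x ∈ capBalancedSet L}.indicator (fun _ => (1 : ℝ)) (linkEmbed L v) *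
          ({x : LinkSpace L | ‖x‖ ≤ Rin}.indicator (fun _ => (1 : ℝ)) (linkEmbed L v) *
            (Real.exp (-(q β (linkEmbed L v))) * Real.exp (-(‖(gaugeModes L).starProjection (linkEmbed L v)‖ ^ 2 / powScale 1 β ^ 2)))) * (∫ c, fpFibreTransfer L β Ω W (gaugeTransform (fun _ : Site 3 L => c⁻¹) (orthoTube L 1 v)) 1 ∂haarProbability SU2) ∂orthoTransverse L) + (2 * (20 * ((300000000 * ((Fintype.card (Edge 3 L) : ℝ) + (Fintype.card (Plaquette 3 L × Fin 3) : ℝ) + (Fintype.card (Plaquette 3 L) : ℝ))) ^ 2 * β ^ 2 * (4 + Real.sqrt (8 * (Fintype.card (Plaquette 3 1) : ℝ) * (L : ℝ) ^ 3)) ^ 2) * linkCE ((L : ℝ) ^ 3 * β)) * linkCE ((L : ℝ) ^ 3 * β)) * (∫ v, {x : LinkSpace L | linkCurry x ∈ capBalancedSet L}.indicator (fun _ => (1 : ℝ)) (linkEmbed L v) *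
          ({x : LinkSpace L | ‖x‖ ≤ Rin}.indicator (fun _ => (1 : ℝ)) (linkEmbed L v) *
            (Real.exp (-(q β (linkEmbed L v))) * Real.exp (-(‖(gaugeModes L).starProjection (linkEmbed L v)‖ ^ 2 / powScale 1 β ^ 2)))) * (‖linkEmbed L v‖ ^ 2) ^ 2 * (∫ c, fpFibreTransfer L β Ω W (gaugeTransform (fun _ : Site 3 L => c⁻¹) (orthoTube L 1 v)) 1 ∂haarProbability SU2) ∂orthoTransverse L) + (16 * ((300000000 * ((Fintype.card (Edge 3 L) : ℝ) + (Fintype.card (Plaquette 3 L × Fin 3) : ℝ) + (Fintype.card (Plaquette 3 L) : ℝ))) ^ 2 * β ^ 2 * (4 + Real.sqrt (8 * (Fintype.card (Plaquette 3 1) : ℝ) * (L : ℝ) ^ 3)) ^ 2) * linkCE ((L : ℝ) ^ 3 * β) * linkCE ((L : ℝ) ^ 3 * β)) * ((∫ v, {x : LinkSpace L | linkCurry x ∈ capBalancedSet L}.indicator (fun _ => (1 : ℝ)) (linkEmbed L v) *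
          ({x : LinkSpace L | ‖x‖ ≤ Rin}.indicator (fun _ => (1 : ℝ)) (linkEmbed L v) *
            (Real.exp (-(q β (linkEmbed L v))) * Real.exp (-(‖(gaugeModes L).starProjection (linkEmbed L v)‖ ^ 2 / powScale 1 β ^ 2)))) * (∫ c, fpFibreTransfer L β (fun x => Ω x * (‖x‖ ^ 2) ^ 2) W (gaugeTransform (fun _ : Site 3 L => c⁻¹) (orthoTube L 1 v)) 1 ∂haarProbability SU2) ∂orthoTransverse L) + (∫ v, {x : LinkSpace L | linkCurry x ∈ capBalancedSet L}.indicator (fun _ => (1 : ℝ)) (linkEmbed L v) *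
          ({x : LinkSpace L | ‖x‖ ≤ Rin}.indicator (fun _ => (1 : ℝ)) (linkEmbed L v) *
            (Real.exp (-(q β (linkEmbed L v))) * Real.exp (-(‖(gaugeModes L).starProjection (linkEmbed L v)‖ ^ 2 / powScale 1 β ^ 2)))) * (∫ c, fpFibreTransfer L β Ω (fun g => W g * (∑ x, ‖su2Quat (g x) - 1‖ ^ 2) ^ 2) (gaugeTransform (fun _ : Site 3 L => c⁻¹) (orthoTube L 1 v)) 1 ∂haarProbability SU2) ∂orthoTransverse L))) * ∫ w, orbitDist w ^ 2 * φ w ^ 2 ∂configMeasure SU2 1)) /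
        transferKernel su2Rep ((L : ℝ) ^ 3 * β) (1 : GaugeConfig 3 1 SU2) 1 ^ 2 := by
  haveI := isFiniteMeasure_orthoTransverse L
  have hβ : (0 : ℝ) ≤ β := by linarith
  have hK1p : 0 < transferKernel su2Rep ((L : ℝ) ^ 3 * β) (1 : GaugeConfig 3 1 SU2) 1 := transferKernel_pos su2Rep _ _ _
  have hρ0 : ∀ u w : GaugeConfig 3 1 SU2, 0 ≤ avgKernel ((L : ℝ) ^ 3 * β) u w / transferKernel su2Rep ((L : ℝ) ^ 3 * β) (1 : GaugeConfig 3 1 SU2) 1 :=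
    fun u w => div_nonneg (avgKernel_pos _ u w).le hK1p.le
  -- the reweighted profiles / weights: measurability, bounds, signs
  have hΩk0 : ∀ (k : ℕ) (x : LinkSpace L), 0 ≤ Ω x * (‖x‖ ^ 2) ^ k := fun k x => mul_nonneg (hΩ0 x) (by positivity)
  have hΩkm : ∀ k : ℕ, Measurable fun x : LinkSpace L => Ω x * (‖x‖ ^ 2) ^ k := fun k => hΩm.mul ((measurable_norm.pow_const 2).pow_const k)
  have hΩkb : ∀ (k : ℕ) (x : LinkSpace L), |Ω x * (‖x‖ ^ 2) ^ k| ≤ CΩ * (R ^ 2) ^ k := fun k x => by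
    have hCΩ0 : 0 ≤ CΩ := (abs_nonneg _).trans (hCΩ 0)
    by_cases hx : Ω x = 0
    · rw [hx, zero_mul, abs_zero]; positivity
    · rw [abs_mul, abs_of_nonneg (by positivity : (0 : ℝ) ≤ (‖x‖ ^ 2) ^ k)]
      exact mul_le_mul (hCΩ x) (pow_le_pow_left₀ (sq_nonneg _) (pow_le_pow_left₀ (norm_nonneg _) (hΩR x hx) 2) k) (by positivity) hCΩ0
  have hWj0 : ∀ (j : ℕ) (g : Site 3 L → SU2), 0 ≤ W g * (∑ x, ‖su2Quat (g x) - 1‖ ^ 2) ^ j := fun j g => mul_nonneg (hW0 g) (pow_nonneg (gaugeDevSq_mem g).1 j)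
  have hWjm : ∀ j : ℕ, Measurable fun g : Site 3 L → SU2 => W g * (∑ x, ‖su2Quat (g x) - 1‖ ^ 2) ^ j := fun j => hWm.mul (measurable_gaugeDevSq.pow_const j)
  have hWjb : ∀ (j : ℕ) (g : Site 3 L → SU2), |W g * (∑ x, ‖su2Quat (g x) - 1‖ ^ 2) ^ j| ≤ CW * (4 * Fintype.card (Site 3 L)) ^ j := fun j g => by
    have hCW0 : 0 ≤ CW := (abs_nonneg _).trans (hCW 1)
    rw [abs_mul, abs_of_nonneg (pow_nonneg (gaugeDevSq_mem g).1 j)]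
    exact mul_le_mul (hCW g) (pow_le_pow_left₀ (gaugeDevSq_mem g).1 (gaugeDevSq_mem g).2 j) (pow_nonneg (gaugeDevSq_mem g).1 j) hCW0
  obtain ⟨B₀, hB₀⟩ := abs_fpFibreTransfer_le' (L := L) β hCΩ hCW
  obtain ⟨B₁, hB₁⟩ := abs_fpFibreTransfer_le' (L := L) β (hΩkb 2) hCW
  obtain ⟨B₂, hB₂⟩ := abs_fpFibreTransfer_le' (L := L) β hCΩ (hWjb 2)
  obtain ⟨B₃, hB₃⟩ := abs_fpFibreTransfer_le' (L := L) β (hΩkb 4) hCW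
  obtain ⟨B₄, hB₄⟩ := abs_fpFibreTransfer_le' (L := L) β hCΩ (hWjb 4)
  have hYb : ∀ {Ωm : LinkSpace L → ℝ} {Wm : (Site 3 L → SU2) → ℝ} {Bm : ℝ}, (∀ x, 0 ≤ Ωm x) → (∀ g, 0 ≤ Wm g) →
      (∀ (U : GaugeConfig 3 L SU2) (u : GaugeConfig 3 1 SU2), |fpFibreTransfer L β Ωm Wm U u| ≤ Bm) → ∀ v : Edge 3 L → Fin 3 → ℝ,
      0 ≤ ∫ c, fpFibreTransfer L β Ωm Wm (gaugeTransform (fun _ : Site 3 L => c⁻¹) (orthoTube L 1 v)) 1 ∂haarProbability SU2 ∧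
        ∫ c, fpFibreTransfer L β Ωm Wm (gaugeTransform (fun _ : Site 3 L => c⁻¹) (orthoTube L 1 v)) 1 ∂haarProbability SU2 ≤ |Bm| := by
    intro Ωm Wm Bm hΩm0 hWm0 hBm v
    refine ⟨integral_nonneg fun c => fpFibreTransfer_nonneg β hΩm0 hWm0 _ _, ?_⟩
    calc ∫ c, fpFibreTransfer L β Ωm Wm (gaugeTransform (fun _ : Site 3 L => c⁻¹) (orthoTube L 1 v)) 1 ∂haarProbability SU2
        ≤ ∫ _c, |Bm| ∂haarProbability SU2 :=
          integral_mono_of_nonneg (ae_of_all _ fun c => fpFibreTransfer_nonneg β hΩm0 hWm0 _ _) (integrable_const _)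
            (ae_of_all _ fun c => (le_abs_self _).trans ((hBm _ _).trans (le_abs_self _)))
      _ = |Bm| := by rw [integral_const, smul_eq_mul, probReal_univ, one_mul]
  have hY0 := hYb hΩ0 hW0 hB₀
  have hY1 := hYb (hΩk0 2) hW0 hB₁
  have hY2 := hYb hΩ0 (hWj0 2) hB₂
  have hY3 := hYb (hΩk0 4) hW0 hB₃
  have hY4 := hYb hΩ0 (hWj0 4) hB₄
  have hY0m := measurable_colour_central_transfer (L := L) β hΩm hWm
  have hY1m := measurable_colour_central_transfer (L := L) β (hΩkm 2) hWm
  have hY2m := measurable_colour_central_transfer (L := L) β hΩm (hWjm 2)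
  have hY3m := measurable_colour_central_transfer (L := L) β (hΩkm 4) hWm
  have hY4m := measurable_colour_central_transfer (L := L) β hΩm (hWjm 4)
  -- the capped inner weight and the fibre amplitude
  have hwm : Measurable fun v : Edge 3 L → Fin 3 → ℝ => {x : LinkSpace L | linkCurry x ∈ capBalancedSet L}.indicator (fun _ => (1 : ℝ)) (linkEmbed L v) *
          ({x : LinkSpace L | ‖x‖ ≤ Rin}.indicator (fun _ => (1 : ℝ)) (linkEmbed L v) *
            (Real.exp (-(q β (linkEmbed L v))) * Real.exp (-(‖(gaugeModes L).starProjection (linkEmbed L v)‖ ^ 2 / powScale 1 β ^ 2)))) :=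
    (measurable_capInnerWeight (L := L) hqm Rin).comp (measurable_linkEmbed L)
  have hw : ∀ v : Edge 3 L → Fin 3 → ℝ, 0 ≤ {x : LinkSpace L | linkCurry x ∈ capBalancedSet L}.indicator (fun _ => (1 : ℝ)) (linkEmbed L v) *
          ({x : LinkSpace L | ‖x‖ ≤ Rin}.indicator (fun _ => (1 : ℝ)) (linkEmbed L v) *
            (Real.exp (-(q β (linkEmbed L v))) * Real.exp (-(‖(gaugeModes L).starProjection (linkEmbed L v)‖ ^ 2 / powScale 1 β ^ 2)))) ∧
      {x : LinkSpace L | linkCurry x ∈ capBalancedSet L}.indicator (fun _ => (1 : ℝ)) (linkEmbed L v) *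
          ({x : LinkSpace L | ‖x‖ ≤ Rin}.indicator (fun _ => (1 : ℝ)) (linkEmbed L v) *
            (Real.exp (-(q β (linkEmbed L v))) * Real.exp (-(‖(gaugeModes L).starProjection (linkEmbed L v)‖ ^ 2 / powScale 1 β ^ 2)))) ≤ 1 := fun v => capInnerWeight_mem_Icc (L := L) hq0 Rin (linkEmbed L v)
  have hwn : ∀ v : Edge 3 L → Fin 3 → ℝ, {x : LinkSpace L | linkCurry x ∈ capBalancedSet L}.indicator (fun _ => (1 : ℝ)) (linkEmbed L v) *
          ({x : LinkSpace L | ‖x‖ ≤ Rin}.indicator (fun _ => (1 : ℝ)) (linkEmbed L v) *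
            (Real.exp (-(q β (linkEmbed L v))) * Real.exp (-(‖(gaugeModes L).starProjection (linkEmbed L v)‖ ^ 2 / powScale 1 β ^ 2)))) ≠ 0 → ‖linkEmbed L v‖ ^ 2 ≤ Rin ^ 2 :=
    fun v hv => sq_norm_le_of_capInnerWeight_ne_zero (L := L) Rin (linkEmbed L v) hv
  have hnm : Measurable fun v : Edge 3 L → Fin 3 → ℝ => ‖linkEmbed L v‖ ^ 2 := (measurable_linkEmbed L).norm.pow_const 2
  have hEm : Measurable fun v : Edge 3 L → Fin 3 → ℝ => Real.exp (-(q β (linkEmbed L v))) := (hqm.comp (measurable_linkEmbed L)).neg.exp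
  have hE : ∀ v : Edge 3 L → Fin 3 → ℝ, 0 ≤ Real.exp (-(q β (linkEmbed L v))) ∧ Real.exp (-(q β (linkEmbed L v))) ≤ 1 :=
    fun v => ⟨Real.exp_nonneg _, Real.exp_le_one_iff.mpr (by linarith [hq0 (linkEmbed L v)])⟩
  -- scalar signs
  have hΛ : 0 ≤ linkCE ((L : ℝ) ^ 3 * β) := (linkCE_pos (by positivity)).le
  have hCB : 0 ≤ (4 * (Fintype.card (Edge 3 1) : ℝ)) ^ 2 * crossBound 1 ((L : ℝ) ^ 3 * β) m := mul_nonneg (sq_nonneg _) (crossBound_pos (L := 1) _ _).le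
  have hφ2 : 0 ≤ ∫ w, φ w ^ 2 ∂configMeasure SU2 1 := integral_nonneg fun w => sq_nonneg _
  have hψ2 : 0 ≤ ∫ w, orbitDist w ^ 2 * φ w ^ 2 ∂configMeasure SU2 1 := integral_nonneg fun w => mul_nonneg (sq_nonneg _) (sq_nonneg _)
  -- the (R3e) switch to the capped inner weight
  rw [integral_outputWeight_eq_capInnerWeight (L := L) q β Rin]
  -- the split, with `Φ = Ω₁·S ≤ Ω₁·SB` pointwise
  refine integral_le_slow_bound_split_of_le (μ := orthoTransverse L)
    (Φ := fun v : Edge 3 L → Fin 3 → ℝ => {x : LinkSpace L | linkCurry x ∈ capBalancedSet L}.indicator (fun _ => (1 : ℝ)) (linkEmbed L v) *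
          ({x : LinkSpace L | ‖x‖ ≤ Rin}.indicator (fun _ => (1 : ℝ)) (linkEmbed L v) *
            (Real.exp (-(q β (linkEmbed L v))) * Real.exp (-(‖(gaugeModes L).starProjection (linkEmbed L v)‖ ^ 2 / powScale 1 β ^ 2)))) *
      ∫ u, {u : GaugeConfig 3 1 SU2 | orbitDist u ≤ dO}.indicator (fun _ => (1 : ℝ)) u *
        ((∫ w, φ w ^ 2 * (avgKernel ((L : ℝ) ^ 3 * β) u w / transferKernel su2Rep ((L : ℝ) ^ 3 * β) (1 : GaugeConfig 3 1 SU2) 1) ∂configMeasure SU2 1) *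
              (40 * (1 + ηc) *
                  ((∫ w, (216 * β * (orbitDist u + orbitDist w) * orbitDist u * Γ +
                    300000000 * ((Fintype.card (Edge 3 L) : ℝ) + (Fintype.card (Plaquette 3 L × Fin 3) : ℝ) + (Fintype.card (Plaquette 3 L) : ℝ)) *
                        (β * ((4 + Real.sqrt (8 * (Fintype.card (Plaquette 3 1) : ℝ) * (L : ℝ) ^ 3)) * (orbitDist u + orbitDist w)) + Real.sqrt β / 2) * min (‖linkEmbed L v‖ ^ 2) (Rin ^ 2) +
                    3 * c₂ * (min (‖linkEmbed L v‖ ^ 2) (Rin ^ 2)) ^ 2) ^ 2 * (avgKernel ((L : ℝ) ^ 3 * β) u w / transferKernel su2Rep ((L : ℝ) ^ 3 * β) (1 : GaugeConfig 3 1 SU2) 1) ∂configMeasure SU2 1) *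
                    (∫ c, fpFibreTransfer L β Ω W (gaugeTransform (fun _ : Site 3 L => c⁻¹) (orthoTube L 1 v)) 1 ∂haarProbability SU2) +
                  (∫ w, (300000000 * ((Fintype.card (Edge 3 L) : ℝ) + (Fintype.card (Plaquette 3 L × Fin 3) : ℝ) + (Fintype.card (Plaquette 3 L) : ℝ)) *
                        (β * ((4 + Real.sqrt (8 * (Fintype.card (Plaquette 3 1) : ℝ) * (L : ℝ) ^ 3)) * (orbitDist u + orbitDist w)) + Real.sqrt β / 2)) ^ 2 * (avgKernel ((L : ℝ) ^ 3 * β) u w / transferKernel su2Rep ((L : ℝ) ^ 3 * β) (1 : GaugeConfig 3 1 SU2) 1) ∂configMeasure SU2 1) *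
                    ((∫ c, fpFibreTransfer L β (fun x => Ω x * (‖x‖ ^ 2) ^ 2) W (gaugeTransform (fun _ : Site 3 L => c⁻¹) (orthoTube L 1 v)) 1 ∂haarProbability SU2) + (∫ c, fpFibreTransfer L β Ω (fun g => W g * (∑ x, ‖su2Quat (g x) - 1‖ ^ 2) ^ 2) (gaugeTransform (fun _ : Site 3 L => c⁻¹) (orthoTube L 1 v)) 1 ∂haarProbability SU2)) +
                  9 * c₂ ^ 2 * (∫ w, (avgKernel ((L : ℝ) ^ 3 * β) u w / transferKernel su2Rep ((L : ℝ) ^ 3 * β) (1 : GaugeConfig 3 1 SU2) 1) ∂configMeasure SU2 1) *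
                    ((∫ c, fpFibreTransfer L β (fun x => Ω x * (‖x‖ ^ 2) ^ 4) W (gaugeTransform (fun _ : Site 3 L => c⁻¹) (orthoTube L 1 v)) 1 ∂haarProbability SU2) + (∫ c, fpFibreTransfer L β Ω (fun g => W g * (∑ x, ‖su2Quat (g x) - 1‖ ^ 2) ^ 4) (gaugeTransform (fun _ : Site 3 L => c⁻¹) (orthoTube L 1 v)) 1 ∂haarProbability SU2))) +
                2 * ηc ^ 2 * (cq * (a₀' * Real.exp (-(q β (linkEmbed L v))))) * ∫ w, (avgKernel ((L : ℝ) ^ 3 * β) u w / transferKernel su2Rep ((L : ℝ) ^ 3 * β) (1 : GaugeConfig 3 1 SU2) 1) ∂configMeasure SU2 1)) ∂configMeasure SU2 1)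
    (w := fun v : Edge 3 L → Fin 3 → ℝ => {x : LinkSpace L | linkCurry x ∈ capBalancedSet L}.indicator (fun _ => (1 : ℝ)) (linkEmbed L v) *
          ({x : LinkSpace L | ‖x‖ ≤ Rin}.indicator (fun _ => (1 : ℝ)) (linkEmbed L v) *
            (Real.exp (-(q β (linkEmbed L v))) * Real.exp (-(‖(gaugeModes L).starProjection (linkEmbed L v)‖ ^ 2 / powScale 1 β ^ 2)))))
    (n := fun v : Edge 3 L → Fin 3 → ℝ => ‖linkEmbed L v‖ ^ 2)
    (Y0 := fun v : Edge 3 L → Fin 3 → ℝ => ∫ c, fpFibreTransfer L β Ω W (gaugeTransform (fun _ : Site 3 L => c⁻¹) (orthoTube L 1 v)) 1 ∂haarProbability SU2)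
    (Y1 := fun v : Edge 3 L → Fin 3 → ℝ => ∫ c, fpFibreTransfer L β (fun x => Ω x * (‖x‖ ^ 2) ^ 2) W (gaugeTransform (fun _ : Site 3 L => c⁻¹) (orthoTube L 1 v)) 1 ∂haarProbability SU2)
    (Y2 := fun v : Edge 3 L → Fin 3 → ℝ => ∫ c, fpFibreTransfer L β Ω (fun g => W g * (∑ x, ‖su2Quat (g x) - 1‖ ^ 2) ^ 2) (gaugeTransform (fun _ : Site 3 L => c⁻¹) (orthoTube L 1 v)) 1 ∂haarProbability SU2)
    (Y3 := fun v : Edge 3 L → Fin 3 → ℝ => ∫ c, fpFibreTransfer L β (fun x => Ω x * (‖x‖ ^ 2) ^ 4) W (gaugeTransform (fun _ : Site 3 L => c⁻¹) (orthoTube L 1 v)) 1 ∂haarProbability SU2)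
    (Y4 := fun v : Edge 3 L → Fin 3 → ℝ => ∫ c, fpFibreTransfer L β Ω (fun g => W g * (∑ x, ‖su2Quat (g x) - 1‖ ^ 2) ^ 4) (gaugeTransform (fun _ : Site 3 L => c⁻¹) (orthoTube L 1 v)) 1 ∂haarProbability SU2)
    (E := fun v : Edge 3 L → Fin 3 → ℝ => Real.exp (-(q β (linkEmbed L v))))
    (KN := 300000000 * ((Fintype.card (Edge 3 L) : ℝ) + (Fintype.card (Plaquette 3 L × Fin 3) : ℝ) + (Fintype.card (Plaquette 3 L) : ℝ))) (AL := 4 + Real.sqrt (8 * (Fintype.card (Plaquette 3 1) : ℝ) * (L : ℝ) ^ 3)) (CB := (4 * (Fintype.card (Edge 3 1) : ℝ)) ^ 2 * crossBound 1 ((L : ℝ) ^ 3 * β) m) (QG := 216 * β * Γ)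
    (Λ₁ := linkCE ((L : ℝ) ^ 3 * β)) (K1 := transferKernel su2Rep ((L : ℝ) ^ 3 * β) (1 : GaugeConfig 3 1 SU2) 1)
    (φ2 := ∫ w, φ w ^ 2 ∂configMeasure SU2 1) (ψ2 := ∫ w, orbitDist w ^ 2 * φ w ^ 2 ∂configMeasure SU2 1)
    (β := β) (c₂ := c₂) (m := m) (dO := dO) (Rin := Rin) (ηc := ηc) (cq := cq) (a₀' := a₀')
    hwm hnm hY0m hY1m hY2m hY3m hY4m hEm hw (fun v => sq_nonneg _) hwn hY0 hY1 hY2 hY3 hY4 hE hΛ hCB hβ hφ2 hψ2 hηc (fun v => ⟨?_, ?_⟩)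
  · -- `0 ≤ Ω₁ · S`
    refine mul_nonneg (hw v).1 (integral_nonneg fun u => ?_)
    refine mul_nonneg (Set.indicator_nonneg (fun _ _ => zero_le_one) _) ?_
    refine mul_nonneg (integral_nonneg fun w => mul_nonneg (sq_nonneg _) (hρ0 u w)) (add_nonneg ?_ ?_)
    · refine mul_nonneg (mul_nonneg (by norm_num) (by linarith)) (add_nonneg (add_nonneg ?_ ?_) ?_)
      · exact mul_nonneg (integral_nonneg fun w => mul_nonneg (sq_nonneg _) (hρ0 u w)) (hY0 v).1
      · exact mul_nonneg (integral_nonneg fun w => mul_nonneg (sq_nonneg _) (hρ0 u w)) (add_nonneg (hY1 v).1 (hY2 v).1)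
      · exact mul_nonneg (mul_nonneg (mul_nonneg (by norm_num) (sq_nonneg _)) (integral_nonneg fun w => hρ0 u w)) (add_nonneg (hY3 v).1 (hY4 v).1)
    · exact mul_nonneg (mul_nonneg (mul_nonneg two_pos.le (sq_nonneg _)) (mul_nonneg hcq (mul_nonneg ha₀' (Real.exp_nonneg _)))) (integral_nonneg fun w => hρ0 u w)
  · -- `Ω₁ · S ≤ Ω₁ · SB`
    exact mul_le_mul_of_nonneg_left (slow_side_le (L := L) hβ1 (q := q) hΩ0 hW0 (dO := dO) (Rin := Rin) hΓ hc₂ hm hcq ha₀' hηc hφm hφb v) (hw v).1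

end Summit.QuantumFields.YangMills.Theorems.FemtoTransferGap.TwoLattice.ConstTube

end
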